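import Summits.QuantumFields.QCD.Theorems.ExtinctionBuildsQCD.Negative.VolumeLever

/-!
# `WindowExtinction` (crux stmt-QuantumFields-8964) — negative-side support:
# the quantifier order of TIGHT is load-bearing (uniform-in-`M` TIGHT is false for EVERY witness)

Standing crux disprover, cycle 2 (2026-08-16). The TIGHT clause of the crux reads
`∀ M > M₀, ∀ᶠ k, 1 ≤ E₊|n₋(Γ₅ D_W(U, m_crit(k) − a_k M/Z_k, 1)) − 6(2L_k+1)⁴|`. Its natural strengthening
with the two quantifiers swapped — ONE tail of steps `k ≥ k₀` serving every probe parameter `M > M₀` — is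
refuted pathwise for every `QCDRegularisation` whatsoever (`not_eventually_forall_probe`): at any fixed step `k` the
probe mass `m_crit(k) − a_k M/Z_k` leaves the Wilson hole `[−8, 0]` through `−8` as `M → ∞`
(`exists_probe_below_hole`, using only `a_k > 0`, `Z_m(k) > 0`), and off the hole the TIGHT integrand vanishes
identically (`negCount_hermitianWilson_eq`, landed in `ExtinctionBuildsQCD/Negative/TightPinsLine.lean`), so the
ratio is `0 < 1` (`tightRatio_eq_zero_of_probe_not_mem`, for the ratio on ANY torus). Consequently the
crux-level strengthening (EXTINCT verbatim, TIGHT uniform in `M`) is FALSE (`not_windowExtinction_uniformM`)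
although its TIGHT clause implies the crux's (`tight_of_eventually_forall_probe`). No definitions: pure theorem file.

Reading for provers: in any proof of TIGHT the threshold `k₀(M)` must grow with `M` — quantitatively
`a_k M / Z_m(k) ≤ m_crit(k) + 8 ≤ 8` for `k ≥ k₀(M)` (`Tight.eventually_probe_mem`), i.e.
`k₀(M) ≥ min {k | a_k/Z_m(k) ≤ 8/M}`; no estimate uniform in the probe depth can be an intermediate step.
-/

namespace Summit.QuantumFields.QCD.Theorems.WindowExtinction.Negative

open Filter MeasureTheory
open Literature.MathematicalPhysics.QuantumLattice Literature.MathematicalPhysics.QuantumFieldTheory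
  Literature.Probability.LatticeModels
open Summit.QuantumFields.QCD.Theses.SpectralDefectExtinction
open Summit.QuantumFields.QCD.Theorems.ExtinctionBuildsQCD.Negative

noncomputable section

variable {Nf : ℕ}

/-- **Off the hole the TIGHT ratio vanishes, on every torus.** If the probe mass
`m_crit(k) − a_k M/Z_k` is `> 0` or `< −8`, the TIGHT integrand `|n₋ − 6(2L'+1)⁴|` is identically zero
(`negCount_hermitianWilson_eq`), so `tightRatio reg k L' m M = 0` whatever the weights. [folklore] -/
theorem tightRatio_eq_zero_of_probe_not_mem (reg : QCDRegularisation Nf) (k L' : ℕ) (m : Fin Nf → ℝ)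
    (M : ℝ) (h : 0 < reg.mcrit k - reg.a k * M / reg.Zm k ∨ reg.mcrit k - reg.a k * M / reg.Zm k < -8) :
    tightRatio reg k L' m M = 0 := by
  unfold tightRatio
  simp only [negCount_hermitianWilson_eq h, Nat.cast_mul, Nat.cast_pow, Nat.cast_add, Nat.cast_ofNat,
    Nat.cast_one, sub_self, abs_zero, zero_mul, integral_zero, zero_div]

/-- **At every fixed step some admissible probe lies below the hole.** For every `k` and every
threshold `M₀` there is `M > M₀` with `m_crit(k) − a_k M/Z_k < −8` (take
`M = max (M₀+1) ((m_crit(k)+9) Z_k/a_k)`; only `a_k > 0`, `Z_k > 0` are used). [folklore] -/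
theorem exists_probe_below_hole (reg : QCDRegularisation Nf) (M₀ : ℝ) (k : ℕ) :
    ∃ M : ℝ, M₀ < M ∧ reg.mcrit k - reg.a k * M / reg.Zm k < -8 := by
  have ha := reg.a_pos k
  have hZ := reg.Zm_pos k
  refine ⟨max (M₀ + 1) ((reg.mcrit k + 9) * reg.Zm k / reg.a k), lt_max_of_lt_left (by linarith), ?_⟩
  have h1 : (reg.mcrit k + 9) * reg.Zm k / reg.a k ≤
      max (M₀ + 1) ((reg.mcrit k + 9) * reg.Zm k / reg.a k) := le_max_right _ _
  rw [div_le_iff₀ ha] at h1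
  have h2 : reg.mcrit k + 9 ≤
      reg.a k * max (M₀ + 1) ((reg.mcrit k + 9) * reg.Zm k / reg.a k) / reg.Zm k := by
    rw [le_div_iff₀ hZ]
    linarith
  linarith

/-- **TIGHT cannot hold uniformly in the probe parameter** (on any tori `L'_k`, for any weights): there is
no tail of steps `k` on which `1 ≤ tightRatio reg k (L' k) m M` for ALL `M > M₀`. [folklore] -/
theorem not_eventually_forall_probe (reg : QCDRegularisation Nf) (M₀ : ℝ) (m : Fin Nf → ℝ) (L' : ℕ → ℕ) :
    ¬ ∀ᶠ k : ℕ in atTop, ∀ M : ℝ, M₀ < M → 1 ≤ tightRatio reg k (L' k) m M := by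
  intro h
  obtain ⟨k, hk⟩ := h.exists
  obtain ⟨M, hM, hlt⟩ := exists_probe_below_hole reg M₀ k
  have h1 := hk M hM
  rw [tightRatio_eq_zero_of_probe_not_mem reg k (L' k) m M (Or.inr hlt)] at h1
  norm_num at h1

/-- **The strengthening of `WindowExtinction` with TIGHT uniform in the probe parameter is FALSE.** Verbatim
crux with `∀ M > M₀, ∀ᶠ k` replaced by `∀ᶠ k, ∀ M > M₀` in the TIGHT conjunct (EXTINCT through the landed `Extinct`,
the TIGHT ratio through the landed `tightRatio`, both definitionally the route's text): already at `N_f = 2`, for the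
witness's own `reg`, `M₀` and the tuple `m ≡ M₀ + 1`, `not_eventually_forall_probe` applies. The uniform clause implies
the crux's TIGHT (`h.mono fun k hk => hk M hM`), so this refutes a STRENGTHENING only: the quantifier order
`∀ M, ∀ᶠ k` of the crux is load-bearing. [folklore] -/
theorem not_windowExtinction_uniformM :
    ¬ ∀ Nf : ℕ, (Nf = 2 ∨ Nf = 3) → ∃ reg : QCDRegularisation Nf, reg.HasMassScaling ∧
      (reg.scheme 0 0 0).HasAsymptoticScaling ∧ ∃ M₀ : ℝ, 0 ≤ M₀ ∧ ∃ c : ℝ, 0 < c ∧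
        ∀ m : Fin Nf → ℝ, (∀ f, M₀ < m f) → Extinct Nf reg c m ∧
          ∀ᶠ k : ℕ in atTop, ∀ M : ℝ, M₀ < M → 1 ≤ tightRatio reg k (reg.L k) m M := by
  intro h
  obtain ⟨reg, -, -, M₀, -, c, -, hm⟩ := h 2 (Or.inl rfl)
  exact not_eventually_forall_probe reg M₀ (fun _ => M₀ + 1) reg.L
    (hm (fun _ => M₀ + 1) fun _ => by linarith).2

/-- The uniform clause is a strengthening of the crux's TIGHT (so the refutation above concerns a strengthening,
not the crux). [folklore] -/
theorem tight_of_eventually_forall_probe (reg : QCDRegularisation Nf) (M₀ : ℝ) (m : Fin Nf → ℝ)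
    (h : ∀ᶠ k : ℕ in atTop, ∀ M : ℝ, M₀ < M → 1 ≤ tightRatio reg k (reg.L k) m M) : Tight Nf reg M₀ m :=
  (tight_iff_tightRatio reg M₀ m).2 fun M hM => h.mono fun _ hk => hk M hM

end

end Summit.QuantumFields.QCD.Theorems.WindowExtinction.Negative
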